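import Mathlib
import Literature.Computability.MetaComplexity.SparseTallyJuntaBounds
import HarnessLib

/-!
# Every `1`-sparse language is decided by ONE linear-threshold gate per length: the method ceiling
of `1`-sparse witnesses against threshold-circuit WIRES

`SparseTallyJuntaBounds.lean` proves the hypotheses `ChenJinWilliams2019.SparseNPTCHardAt c₀ d ε`
(census row R49 item 7) for every `ε < 0` with a `1`-sparse witness, and shows that this particular
witness (the tally language) lies INSIDE the class at every `ε ≥ 0`.  This file closes the question
for ALL `1`-sparse languages: if every length carries at most one word of `L`
(`IsSparse (fun _ ↦ 1) L`), then `L ∈ TCdWIRESae D s` for every depth `D ≥ 1` and every wire budget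
eventually `≥ n` — at length `n` the slice indicator `x ↦ [x ∈ L]` is itself a linear threshold
gate: the equality test with the unique word `w` (weights `±1`, threshold `#₁(w)`), or the constant
`0` (weights `0`, threshold `1`) when the slice is empty.  Consequently NO `1`-sparse language can
witness `SparseNPTCHardAt c₀ d ε` at any `ε ≥ 0` with `d ≥ 1`: the KNOWN cell "every `ε < 0`" of
row R49 item 7 is the exact reach of `1`-sparse evidence (a quantified METHOD CEILING, not a remark).

Main statements:
* `ltf_eq_test` — `[x = w] = [θ ≤ Σᵢ cᵢ xᵢ]` with `cᵢ = ±1`, `θ = #₁(w)`.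
* `isLTF_sliceIndicator_of_ncard_le_one` — the slice indicator of a language with `≤ 1` word of
  length `n` is an LTF gate of arity `n`.
* `mem_TCdWIRESae_of_isSparse_one` — `IsSparse (fun _ ↦ 1) L → 1 ≤ D → (∀ᶠ n, n ≤ s n) →
  L ∈ TCdWIRESae D s`; corollaries `mem_TCdWIRESae_powCeil_of_isSparse_one` (`e ≥ 1`) and
  `ChenJinWilliams2019.mem_TCdWIRESae_tcDepth_of_isSparse_one` (`ε ≥ 0`, row vocabulary).

All statements are folklore and fully proved; no definition, no named fact.

References: L. Chen, C. Jin, R. Williams, *Hardness magnification for all sparse NP languages*,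
FOCS 2019 / ECCC TR19-118, Thm. 1.1 item 7 (the hypothesis whose `1`-sparse reach is computed here);
S. Jukna, *Boolean Function Complexity* (Springer 2012), §11.10 p. 338 (threshold circuits: functions
depending on all variables with three gates — gates versus wires).
-/

open Finset Filter

namespace Literature.Computability.MetaComplexity

open Literature.Computability.Complexity Literature.Computability.Complexity.Circuit
open Literature.Computability.MetaComplexity.ChenJinWilliams2019
open scoped Classical

/-! ### The equality test is a linear threshold gate -/

/-- **Equality with a fixed word is an LTF predicate**: with weights `cᵢ = 1` if `wᵢ = 1` and
`cᵢ = −1` otherwise, and threshold `θ = #{i | wᵢ = 1}`, one has `[x = w] = [θ ≤ Σᵢ cᵢ·xᵢ]`.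
[folklore] -/
theorem ltf_eq_test {n : ℕ} (w : Fin n → Bool) :
    ∃ (c : Fin n → ℤ) (θ : ℤ), ∀ x : Fin n → Bool,
      decide (x = w) = decide (θ ≤ ∑ i, if x i then c i else 0) := by
  refine ⟨fun i => if w i then 1 else -1, ∑ i, if w i then (1 : ℤ) else 0, fun x => ?_⟩
  dsimp only
  have hle : ∀ i ∈ (univ : Finset (Fin n)),
      (if x i then (if w i then (1 : ℤ) else -1) else 0) ≤ (if w i then (1 : ℤ) else 0) := by
    intro i _
    cases x i <;> cases w i <;> simp
  have hiff : ∀ i : Fin n,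
      ((if x i then (if w i then (1 : ℤ) else -1) else 0) = (if w i then (1 : ℤ) else 0)) ↔
        x i = w i := by
    intro i
    cases x i <;> cases w i <;> simp
  refine decide_eq_decide.2 ⟨fun h => ?_, fun h => ?_⟩
  · rw [h]
    exact (Finset.sum_congr rfl fun i _ => by cases w i <;> simp).le
  · have heq : (∑ i, if x i then (if w i then (1 : ℤ) else -1) else 0) =
        ∑ i, if w i then (1 : ℤ) else 0 := le_antisymm (Finset.sum_le_sum hle) h
    funext i
    exact (hiff i).1 ((Finset.sum_eq_sum_iff_of_le hle).1 heq i (mem_univ i))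

/-- The word of length `n` read as an input vector reproduces the word. [folklore] -/
theorem ofFn_getD_eq {w : List Bool} {n : ℕ} (hw : w.length = n) :
    List.ofFn (fun i : Fin n => w.getD i false) = w := by
  subst hw
  apply List.ext_getElem (by simp)
  intro i h₁ h₂
  simp

/-- **The slice indicator of a language with at most one word of length `n` is a linear
threshold gate** (of arity `n`): the equality test with that word, or the constant `0`.
[folklore] -/
theorem isLTF_sliceIndicator_of_ncard_le_one (L : Language Bool) {n : ℕ}
    (h : {x : List Bool | x ∈ L ∧ x.length = n}.ncard ≤ 1) :
    GateFn.IsLTF ⟨n, fun x => decide (List.ofFn x ∈ L)⟩ := by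
  by_cases hne : ∃ w : List Bool, w ∈ L ∧ w.length = n
  · obtain ⟨w, hwL, hwn⟩ := hne
    have hfin : {x : List Bool | x ∈ L ∧ x.length = n}.Finite :=
      (List.finite_length_eq Bool n).subset fun x hx => hx.2
    have huniq : ∀ x : Fin n → Bool, List.ofFn x ∈ L ↔ x = fun i : Fin n => w.getD i false := by
      intro x
      constructor
      · intro hx
        apply List.ofFn_injective
        rw [ofFn_getD_eq hwn]
        exact (Set.ncard_le_one hfin).1 h _ ⟨hx, List.length_ofFn⟩ _ ⟨hwL, hwn⟩
      · rintro rfl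
        rwa [ofFn_getD_eq hwn]
    obtain ⟨c, θ, hc⟩ := ltf_eq_test (fun i : Fin n => w.getD i false)
    refine ⟨c, θ, fun x => ?_⟩
    change decide (List.ofFn x ∈ L) = _
    rw [← hc x]
    exact decide_eq_decide.2 (huniq x)
  · refine ⟨fun _ => 0, 1, fun x => ?_⟩
    change decide (List.ofFn x ∈ L) = _
    have hx : List.ofFn x ∉ L := fun hx => hne ⟨_, hx, List.length_ofFn⟩
    simp [hx]

/-! ### The method ceiling -/

/-- **Every `1`-sparse language is in `TCdWIRESae D s` for every depth `D ≥ 1` and every wire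
budget eventually `≥ n`**: one LTF gate of fan-in `n` per length (`n` wires, depth `1`).
[folklore] -/
theorem mem_TCdWIRESae_of_isSparse_one {L : Language Bool} (hL : IsSparse (fun _ => 1) L) {D : ℕ}
    (hD : 1 ≤ D) {s : ℕ → ℕ} (hs : ∃ n₀ : ℕ, ∀ n ≥ n₀, n ≤ s n) : L ∈ TCdWIRESae D s := by
  obtain ⟨n₀, hn₀⟩ := hs
  refine ⟨fun n => Circuit.single (⟨n, fun x => decide (List.ofFn x ∈ L)⟩ : GateFn) (finCongr rfl),
    ⟨n₀, fun n hn => ⟨?_, ?_, ?_⟩⟩, ?_⟩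
  · exact Circuit.single_isOver (isLTF_sliceIndicator_of_ncard_le_one L (hL n)) _
  · exact (ChenTell2019.acDepth_single_le _ _).trans hD
  · rw [ChenTell2019.wires_single]
    exact hn₀ n hn
  · refine ChenTell2019.decides_single (fun n => (⟨n, fun x => decide (List.ofFn x ∈ L)⟩ : GateFn))
      (fun _ => rfl) L fun x => ?_
    change _ ↔ decide (List.ofFn (fun a : Fin x.length => x.get (Fin.cast rfl a)) ∈ L) = true
    rw [decide_eq_true_iff]
    have hx : (List.ofFn fun a : Fin x.length => x.get (Fin.cast rfl a)) = x := List.ofFn_get x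
    rw [hx]

/-- At budget `⌈n^e⌉`, `e ≥ 1`, and any depth `D ≥ 1`, every `1`-sparse language is INSIDE the
wires class. [folklore] -/
theorem mem_TCdWIRESae_powCeil_of_isSparse_one {L : Language Bool} (hL : IsSparse (fun _ => 1) L)
    {D : ℕ} (hD : 1 ≤ D) {e : ℝ} (he : 1 ≤ e) : L ∈ TCdWIRESae D (powCeil e) := by
  refine mem_TCdWIRESae_of_isSparse_one hL hD ⟨1, fun n hn => ?_⟩
  unfold powCeil
  have h1 : (n : ℝ) ≤ (n : ℝ) ^ e := by
    calc (n : ℝ) = (n : ℝ) ^ (1 : ℝ) := (Real.rpow_one _).symm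
      _ ≤ (n : ℝ) ^ e := Real.rpow_le_rpow_of_exponent_le (by exact_mod_cast hn) he
  exact_mod_cast h1.trans (Nat.le_ceil _)

namespace ChenJinWilliams2019

/-- **Method ceiling for row R49 item 7, in the row's vocabulary.** For every `ε ≥ 0`, every `c₀`
and every `d ≥ 1`, EVERY `1`-sparse language lies in `TCdWIRESae (tcDepth c₀ d ε) ⌈n^{1+ε}⌉`; so a
witness of `SparseNPTCHardAt c₀ d ε` at `ε ≥ 0` is not `1`-sparse, i.e. has at least two words at
SOME length (as typed here, from `IsSparse (fun _ ↦ 1)` = at most one word at EVERY length; the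
stronger "at least two words at infinitely many lengths" also holds — the same one-gate family works
under EVENTUAL `1`-sparsity because the class is almost-everywhere — and is in tree for `d ≥ 2`,
`ε > 0` as the instance `S ≡ 1`, `δ = 0` of
`SparseDepthTwoThresholdWires.mem_TCdWIRESae_of_sparse` /
`ChenJinWilliams2019.frequently_dense_of_witness`) — the KNOWN cell "every `ε < 0`"
(`sparseNPTCHardAt_of_neg`) is the exact reach of `1`-sparse
evidence. [cite: ChenJinWilliams2019, Thm. 1.1 item 7 (hypothesis shape; ceiling folklore)] -/
theorem mem_TCdWIRESae_tcDepth_of_isSparse_one {L : Language Bool} (hL : IsSparse (fun _ => 1) L)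
    (c₀ : ℕ) {d : ℕ} (hd : 1 ≤ d) {ε : ℝ} (hε : 0 ≤ ε) :
    L ∈ TCdWIRESae (tcDepth c₀ d ε) (powCeil (1 + ε)) :=
  mem_TCdWIRESae_powCeil_of_isSparse_one hL (hd.trans (le_tcDepth c₀ d ε)) (by linarith)

/-- The ceiling as a non-witnessing statement: at `ε ≥ 0`, `d ≥ 1`, no `1`-sparse language (in
`NP` or not) is outside the row's class. [folklore] -/
theorem not_exists_sparse_one_witness (c₀ : ℕ) {d : ℕ} (hd : 1 ≤ d) {ε : ℝ} (hε : 0 ≤ ε) :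
    ¬ ∃ L : Language Bool, IsSparse (fun _ => 1) L ∧
      L ∉ TCdWIRESae (tcDepth c₀ d ε) (powCeil (1 + ε)) :=
  fun ⟨_, hL, hnot⟩ => hnot (mem_TCdWIRESae_tcDepth_of_isSparse_one hL c₀ hd hε)

end ChenJinWilliams2019

end Literature.Computability.MetaComplexity
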